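import Summits.QuantumFields.YangMills.Theorems.UnitScaleTiltHalvingP1FlatCoreJunction
import Summits.QuantumFields.YangMills.Theorems.UnitScaleTiltHalvingP1FlatCoreDP1OfTop
import HarnessLib

/-!
# `hP1room` PROGRAMME (LEAD-H «H = hP1room» BOARD v1, RULING L-9; ★w3-20520 g6 (A-1) STAGE 2): ★ THE FOUR DEFINITIONAL BRICKS (T1)–(T4) OF THE SUPPLIER DOOR —
# the accumulated-frame tower `ν`, the pulled-back pre-gauge tower `gs′`, the `ℤ³` gauge `w` DEFINED by the composite-gauge identity `hug`, and the chart identity `hX`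
# for the one-form DEFINED as the logarithm of the gauged window field

Route `UnitScaleTilt`, crux K1 child «MinimiserStabilityRegPr» (stmt-QuantumFields-19200), registered stub `stub_halvingStep` (`BirthV10`), text `hP1room ⟸ hSupU`.
Cell `ym3-torus` (HUMAN RULING D-0037: YM₃ on T³ is ladder rung R3 — NOT d = 4, NOT a mass gap, NOT the Clay problem), width seat `ym-ust-19200-w6` gen 2
(★w3-20520 g6 14:29:47Z «(s-2) IS YOURS, widened to the four definitional bricks STAGE 2 imports»; letters = ✓p638875
`HalvingP1FlatCoreChartDataDoor.mlogChartDataMult_of_suppliers` :84–:108 VERBATIM).  `--supports stmt-QuantumFields-19200 --as helper`; THEOREMS ONLY (0 `def`, 0 `sorry`);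
count-neutral; nothing here claims `core′`, `hP1room`, `hSupU`, the stub, the crux or the gap.

WHAT (member `(F, n, K)`, values in `Matrix (Fin 2) (Fin 2) ℂ`):
* (T1) ★`exists_nuTower (W)` — `∃ ν, (∀ s, ν 0 s = 1) ∧ ∀ i y, ν (i+1) y = ν i (emb y) * vframeU (dbarIterU i W) y` (the door's `hν0`∕`hνs`; consumer
  `W := gaugeActT g (unitsField (toUField U))`).
* (T2) ★`exists_gsTower (g)` — `∃ gs′, gs′ 0 = g ∧ ∀ i y, gs′ (i+1) y = gs′ i (emb y)` (the door's `hg0`∕`hgs`).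
* (T3) ★★`exists_w_of_su2 (x₀) (G) (hG : ∀ s, ↑(G s) ∈ SU(2))` — `∃ w : ℤ³ → SU(2), (∀ z, (toUnits (suIncl (w z)))⁻¹ = G (0 + z)) ∧ ∀ s, (toUnits (suIncl (w (rep s))))⁻¹ = G s`
  (`rep s = lift x₀ + rel x₀ s`; consumer `G s := ((gs′ k y₀)⁻¹ * ν k y₀) * h′ s * g s` ⇒ the door's `hug` VERBATIM).
* (T4) ★`smul_smul_mlogChart (η ≠ 0) (m)` — `I • (η • (−(I • (η⁻¹ • m)))) = m`; ★`hX_of_def` — the door's `hX` row (:84–:87 shape) for the one-form DEFINED by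
  `X z ν := −(I • (η⁻¹ • mlog (w(z)⁻¹·U⟨0+z,ν⟩·w(z+e_ν))))`, `η = L^{−(K−n)}` — an identity.
HONEST SCOPE.  Definitions-as-∃ and two identities; no analysis; nothing of N05's output, of the top step, of `core′` or the stub is proved here.

References: T. Bałaban, CMP **99** (1985) 75–102 [Balaban1985RegularSpaces] ((1.36)–(1.38) p.82, (1.91) p.98); CMP **98** (1985) 17–51 [Balaban1985Averaging]
((8) p.19, (92) p.31, (110) p.34); CMP **102** (1985) 277–309 [Balaban1985Variational] ((152)–(156) pp.301–302).
-/

set_option autoImplicit false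

noncomputable section

open scoped BigOperators Matrix.Norms.L2Operator

namespace Summit.QuantumFields.YangMills.Theorems.HalvingP1FlatCoreSupplierTowers

open Literature.MathematicalPhysics.QuantumFieldTheory.Balaban1983to89
open Literature.MathematicalPhysics.QuantumFieldTheory.Balaban1983to89.T3ContinuumYM3Torus
open Complex (I)
open MatrixLog (mlog)
open B7Prop1Explicit renaming Site → LSite
open B7Prop1Explicit (e)
open B8Eq131Cubes (cube)
open B10Eq27TorusAxialLog (transl rel unitsField toUField suIncl val_suIncl)
open B15Eq112TorusCover (lift)
open FlatCubeSequenceAligned (cubeSetM)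
open P1FlatCoreCubeInclusion (transl_zero_eq_cover cover_lift_add_rel)
open Summit.QuantumFields.YangMills.Theorems.Prop8ChartDoubleBar (dbarIterU vframeU)

variable {F : T3Family} {n K : ℕ}

/-! ## (T1) The accumulated-frame tower `ν` -/

/-- ★ **(T1) THE ACCUMULATED-FRAME TOWER** of a fine field `W`: `ν₀ = 1`, `ν_{i+1}(y) = ν_i(emb y) · v(U̿^{(i)}W)(y)` — the door's `hν0`∕`hνs` rows hold for the tower
DEFINED by that recursion. [cite: Balaban1985Averaging, (110) p.34, (92) p.31] -/
theorem exists_nuTower (W : GaugeField (F.P K) 0 (Matrix (Fin 2) (Fin 2) ℂ)ˣ) :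
    ∃ ν : (i : ℕ) → Site (F.P K) i → (Matrix (Fin 2) (Fin 2) ℂ)ˣ, (∀ s, ν 0 s = 1) ∧
      ∀ (i : ℕ) (y : Site (F.P K) (i + 1)), ν (i + 1) y = ν i (emb y) * vframeU (dbarIterU i W) y :=
  ⟨fun i => Nat.rec (motive := fun i => Site (F.P K) i → (Matrix (Fin 2) (Fin 2) ℂ)ˣ) (fun _ => 1)
      (fun i νi y => νi (emb y) * vframeU (dbarIterU i W) y) i,
    fun _ => rfl, fun _ _ => rfl⟩

/-! ## (T2) The pulled-back pre-gauge tower `gs′` -/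

/-- ★ **(T2) THE PRE-GAUGE PULLED BACK ALONG THE CENTRE EMBEDDINGS**: `gs′₀ = g`, `gs′_{i+1}(y) = gs′_i(emb y)` — the door's `hg0`∕`hgs` rows hold for the tower DEFINED by that
recursion. [cite: Balaban1985Averaging, (8) p.19, (92) p.31] -/
theorem exists_gsTower (g : GaugeTransf (F.P K) 0 (Matrix (Fin 2) (Fin 2) ℂ)ˣ) :
    ∃ gs' : (i : ℕ) → GaugeTransf (F.P K) i (Matrix (Fin 2) (Fin 2) ℂ)ˣ, gs' 0 = g ∧
      ∀ (i : ℕ) (y : Site (F.P K) (i + 1)), gs' (i + 1) y = gs' i (emb y) :=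
  ⟨fun i => Nat.rec (motive := fun i => GaugeTransf (F.P K) i (Matrix (Fin 2) (Fin 2) ℂ)ˣ) g (fun _ gi y => gi (emb y)) i,
    rfl, fun _ _ => rfl⟩

/-! ## (T3) The `ℤ³` gauge `w` defined by the composite-gauge identity -/

/-- ★★ **(T3) THE `ℤ³` GAUGE DEFINED BY `hug`**: for an `SU(2)`-valued torus field of units `G`, the periodic pull-back `w z := (G (0 + z))⁻¹` (as an `SU(2)` element) has
`(toUnits (suIncl (w z)))⁻¹ = G (0 + z)` for every `z ∈ ℤ³`, hence `(toUnits (suIncl (w (rep s))))⁻¹ = G s` at the window representative `rep s = lift x₀ + rel x₀ s` of every torus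
site (`0 + rep s = s`) — the door's `hug` row VERBATIM for `G s := ((gs′ k y₀)⁻¹ ν k y₀)·h′ s·g s`. [cite: Balaban1985RegularSpaces, (1.91) p.98; Balaban1985Averaging, (8) p.19] -/
theorem exists_w_of_su2 (x₀ : Site (F.P K) 0) (G : Site (F.P K) 0 → (Matrix (Fin 2) (Fin 2) ℂ)ˣ)
    (hG : ∀ s, ((G s : (Matrix (Fin 2) (Fin 2) ℂ)ˣ) : Matrix (Fin 2) (Fin 2) ℂ) ∈ Matrix.specialUnitaryGroup (Fin 2) ℂ) :
    ∃ w : LSite (F.P K).d → Matrix.specialUnitaryGroup (Fin 2) ℂ,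
      (∀ z : LSite (F.P K).d, (Unitary.toUnits (suIncl (w z)))⁻¹ = G (transl (0 : Site (F.P K) 0) z)) ∧
      ∀ s : Site (F.P K) 0, (Unitary.toUnits (suIncl (w (lift (F.P K) x₀ + rel x₀ s))))⁻¹ = G s := by
  have key : ∀ s : Site (F.P K) 0,
      (Unitary.toUnits (suIncl ((⟨(G s : Matrix (Fin 2) (Fin 2) ℂ), hG s⟩ : Matrix.specialUnitaryGroup (Fin 2) ℂ)⁻¹)))⁻¹ = G s := by
    intro s
    rw [map_inv, map_inv, inv_inv]
    exact Units.ext rfl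
  refine ⟨fun z => (⟨(G (transl (0 : Site (F.P K) 0) z) : Matrix (Fin 2) (Fin 2) ℂ), hG _⟩ : Matrix.specialUnitaryGroup (Fin 2) ℂ)⁻¹,
    fun z => key _, fun s => ?_⟩
  have hrep : transl (0 : Site (F.P K) 0) (lift (F.P K) x₀ + rel x₀ s) = s := by
    rw [transl_zero_eq_cover]; exact cover_lift_add_rel x₀ s
  dsimp only
  rw [hrep]
  exact key s

/-! ## (T4) The chart identity for the one-form defined as a logarithm -/

/-- ★ **(T4) `i·η·(−(i·η⁻¹·m)) = m`** (`η ≠ 0`; `i² = −1`): the one-form DEFINED by `X := −i·η⁻¹·log W` satisfies the chart identity `i·η·X = log W` identically.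
[cite: Balaban1985RegularSpaces, (1.36) p.82; Balaban1985Variational, (152) p.301] -/
theorem smul_smul_mlogChart (η : ℝ) (hη : η ≠ 0) (m : Matrix (Fin 2) (Fin 2) ℂ) : I • (η • (-(I • (η⁻¹ • m)))) = m := by
  have hηc : (η : ℂ) ≠ 0 := Complex.ofReal_ne_zero.mpr hη
  ext i j
  simp only [Matrix.smul_apply, Matrix.neg_apply, smul_eq_mul, Complex.real_smul, Complex.ofReal_inv]
  calc I * ((η : ℂ) * -(I * ((η : ℂ)⁻¹ * m i j))) = -(I * I) * ((η : ℂ) * (η : ℂ)⁻¹) * m i j := by ring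
    _ = m i j := by rw [Complex.I_mul_I, mul_inv_cancel₀ hηc]; ring

/-- ★ **(T4, packaged) THE DOOR's `hX` ROW FOR THE ONE-FORM DEFINED AS THE LOGARITHM OF THE GAUGED WINDOW FIELD**: with
`X z ν := −(i·(η⁻¹·log(w(z)⁻¹·U⟨0+z,ν⟩·w(z+e_ν))))`, `η = L^{−(K−n)}`, the row `i·(η·X z ν) = log(w(z)⁻¹·U⟨0+z,ν⟩·w(z+e_ν))` of
✓`HalvingP1FlatCoreChartDataDoor.mlogChartDataMult_of_suppliers` (:84–:87, its window premises unused) holds identically. [cite: Balaban1985RegularSpaces, (1.36)-(1.38) p.82] -/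
theorem hX_of_def (x₀ : Site (F.P K) 0) (ρ S M : ℕ) {a : LSite (F.P K).d} {M' ρ' : ℕ}
    (U : GaugeField (F.P K) 0 (Matrix.specialUnitaryGroup (Fin 2) ℂ)) (w : LSite (F.P K).d → Matrix.specialUnitaryGroup (Fin 2) ℂ) :
    ∀ z ∈ cube (F.P K).L a M' ρ' (K - n) 0, ∀ ν : Fin (F.P K).d,
      transl (0 : Site (F.P K) 0) z ∈ cubeSetM x₀ (K - n) ρ S M 0 → (transl (0 : Site (F.P K) 0) z).shift ν ∈ cubeSetM x₀ (K - n) ρ S M 0 →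
      I • ((((F.L : ℝ)⁻¹) ^ (K - n)) • (fun (z : LSite (F.P K).d) (ν : Fin (F.P K).d) =>
        -(I • (((((F.L : ℝ)⁻¹) ^ (K - n))⁻¹) • mlog (((Unitary.toUnits (suIncl (w z)))⁻¹ * unitsField (toUField U) ⟨transl 0 z, ν⟩ *
          Unitary.toUnits (suIncl (w (z + e ν))) : (Matrix (Fin 2) (Fin 2) ℂ)ˣ) : Matrix (Fin 2) (Fin 2) ℂ)))) z ν) =
        mlog (((Unitary.toUnits (suIncl (w z)))⁻¹ * unitsField (toUField U) ⟨transl 0 z, ν⟩ *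
          Unitary.toUnits (suIncl (w (z + e ν))) : (Matrix (Fin 2) (Fin 2) ℂ)ˣ) : Matrix (Fin 2) (Fin 2) ℂ) := by
  intro z _ ν _ _
  have hη : ((F.L : ℝ)⁻¹) ^ (K - n) ≠ 0 := pow_ne_zero _ (inv_ne_zero (Nat.cast_ne_zero.2 (F.P K).L_pos.ne'))
  exact smul_smul_mlogChart _ hη _

end Summit.QuantumFields.YangMills.Theorems.HalvingP1FlatCoreSupplierTowers

end
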